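import Literature.Algebra.EuclideanLattices.RegevSmoothingLowerBound
import HarnessLib

/-!
# Regev 2009, Theorem 3.1: the radii of the iteration (`rᵢ = r (αp/√n)ⁱ`) and their admissibility

Topic `Algebra/EuclideanLattices` (family `pqc`). Serves the decomposition of the named fact
`Literature.Computability.Cryptography.regev_lwe_to_sivp_quantum` (pqc.S19; Regev, J. ACM 56 (2009),
Thm 1.1): the PROOF OF THEOREM 3.1 (the quantum algorithm for `DGS_{√(2n) η_ε(L)/α}`, hypothesis `h₂`
of `regev_lwe_to_sivp_quantum_of_worstCase`) is a loop over the radii `rᵢ = r (αp/√n)ⁱ`,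
`i = 3n, 3n-1, …, 1` (author's version arXiv:2401.03703, p. 15): *"The algorithm starts by producing
`n^c` samples from `D_{L,r_{3n}}` … By Claim 2.13, `r_{3n} > 2^{3n} r > 2^{2n} λₙ(L)`, and hence we
can produce these samples efficiently by the procedure described in the bootstrapping lemma … for
`i = 3n, …, 1` we use our `n^c` samples from `D_{L,rᵢ}` to produce `n^c` samples from `D_{L,r_{i-1}}`
[the iterative step, Lemma 3.3: from `D_{L,r'}`, `r' > √2 p η_ε(L)`, to `D_{L, r'√n/(αp)}`] … the
condition in Lemma 3.3 is satisfied since for all `i ≥ 1`, `rᵢ ≥ r₁ = rαp/√n > √2 p η_ε(L)`. At the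
end of the loop, we end up with samples from `D_{L,r₀} = D_{L,r}`."*

Everything here is PROVED (theorems only; one definition with body, `regevRadius`): the three
arithmetic facts the loop uses, under the hypotheses of Thm 3.1 (`α ∈ (0,1)`, `αp > 2√n`,
`r > √(2n) η_ε(L)/α`, `n ≥ 1`) and, for the bootstrap bound, Claim 2.13 in the form
`λₙ(L) ≤ n η_ε(L)` valid for `ε ≤ e^{-π}` (so for every negligible `ε` eventually).

## Main results

* `Regev2009.regevRadius r α p n i = r (αp/√n)ⁱ`, `regevRadius_zero`, `regevRadius_succ_mul`
  (`r_{i+1} · √n/(αp) = rᵢ`: one iterative step maps the radius `r_{i+1}` to `rᵢ`).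
* `Regev2009.sqrt_two_mul_mul_lt_regevRadius` — admissibility of every step:
  `√2 p η_ε(L) < rᵢ` for `i ≥ 1`.
* `Regev2009.successiveMinimum_le_mul_smoothingParameter_of_le_exp_neg_pi` — `λₙ(L) ≤ n η_ε(L)` for
  `0 < ε ≤ e^{-π}` (Claim 2.13 with `√(ln(1/ε)/π) ≥ 1`).
* `Regev2009.two_pow_mul_successiveMinimum_lt_regevRadius` — the bootstrap bound
  `2^{2n} λₙ(L) < r_{3n}`.

## References

* O. Regev, *On lattices, learning with errors, random linear codes, and cryptography*, J. ACM 56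
  (2009), art. 34; author's version arXiv:2401.03703, Theorem 3.1 and its proof (p. 15), Claim 2.13,
  Lemmas 3.2–3.3 [Regev2009].
-/

noncomputable section

open Module

namespace Literature.Algebra.EuclideanLattices

namespace Regev2009

/-! ### The radii -/

/-- **The radii of the proof of Theorem 3.1**: `rᵢ = r · (αp/√n)ⁱ`. [cite: Regev2009, Theorem 3.1 (proof)] -/
def regevRadius (r α : ℝ) (p n i : ℕ) : ℝ := r * (α * p / Real.sqrt n) ^ i

/-- `r₀ = r`. [cite: Regev2009, Theorem 3.1 (proof: "D_{L,r₀} = D_{L,r}")] -/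
@[simp] theorem regevRadius_zero (r α : ℝ) (p n : ℕ) : regevRadius r α p n 0 = r := by
  simp [regevRadius]

/-- **One iterative step**: the step of Lemma 3.3 maps samples at `r'` to samples at `r'√n/(αp)`;
with `r' = r_{i+1}` this is `rᵢ`. [cite: Regev2009, Theorem 3.1 (proof) with Lemma 3.3] -/
theorem regevRadius_succ_mul {r α : ℝ} {p n : ℕ} (hα : 0 < α) (hp : 0 < p) (hn : 0 < n) (i : ℕ) :
    regevRadius r α p n (i + 1) * (Real.sqrt n / (α * p)) = regevRadius r α p n i := by
  have hsn : 0 < Real.sqrt n := Real.sqrt_pos.2 (by exact_mod_cast hn)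
  have hαp : 0 < α * p := by positivity
  rw [regevRadius, regevRadius, pow_succ]
  field_simp

/-- The ratio `αp/√n` exceeds `2` under `αp > 2√n`. [cite: Regev2009, Theorem 3.1 (hypothesis αp > 2√n)] -/
theorem two_lt_ratio {α : ℝ} {p n : ℕ} (hn : 0 < n) (hαp : 2 * Real.sqrt n < α * p) :
    2 < α * p / Real.sqrt n := by
  have hsn : 0 < Real.sqrt n := Real.sqrt_pos.2 (by exact_mod_cast hn)
  rwa [lt_div_iff₀ hsn]

/-- The radii increase: `rᵢ ≤ rⱼ` for `i ≤ j` (and `r > 0`). [folklore] -/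
theorem regevRadius_mono {r α : ℝ} {p n : ℕ} (hr : 0 ≤ r) (hn : 0 < n) (hαp : 2 * Real.sqrt n < α * p)
    {i j : ℕ} (hij : i ≤ j) : regevRadius r α p n i ≤ regevRadius r α p n j := by
  unfold regevRadius
  exact mul_le_mul_of_nonneg_left (pow_le_pow_right₀ (by linarith [two_lt_ratio hn hαp]) hij) hr

/-! ### Admissibility of every iterative step -/

/-- **"For all `i ≥ 1`, `rᵢ ≥ r₁ = rαp/√n > √2 p η_ε(L)`"**: every radius fed to the iterative step
(Lemma 3.3, which needs `r' > √2 p η_ε(L)`) is admissible, for `r > √(2n) η_ε(L)/α`, `0 < α`,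
`αp > 2√n`, `n ≥ 1` (and `η ≥ 0`; here `η` is any real standing for `η_ε(L)`).
[cite: Regev2009, Theorem 3.1 (proof)] -/
theorem sqrt_two_mul_mul_lt_regevRadius {r α η : ℝ} {p n : ℕ} (hα : 0 < α) (hn : 0 < n)
    (hαp : 2 * Real.sqrt n < α * p) (hη : 0 ≤ η) (hr : Real.sqrt (2 * n) * η / α < r) {i : ℕ} (hi : 1 ≤ i) :
    Real.sqrt 2 * p * η < regevRadius r α p n i := by
  have hsn : 0 < Real.sqrt n := Real.sqrt_pos.2 (by exact_mod_cast hn)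
  have hp : (0 : ℝ) < p := by
    by_contra h
    push Not at h
    nlinarith [Real.sqrt_nonneg (n : ℝ)]
  have hr0 : 0 < r := lt_of_le_of_lt (by positivity) hr
  -- `r₁ = r αp/√n > √(2n) η/α · αp/√n = √2 p η`
  have h1 : Real.sqrt 2 * p * η < regevRadius r α p n 1 := by
    rw [regevRadius, pow_one]
    have hsq : Real.sqrt (2 * n) = Real.sqrt 2 * Real.sqrt n := Real.sqrt_mul zero_le_two _
    rw [hsq, div_lt_iff₀ hα] at hr
    -- hr : √2 √n η < r α
    rw [mul_div_assoc', lt_div_iff₀ hsn]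
    nlinarith [mul_lt_mul_of_pos_right hr hp, Real.sqrt_nonneg (2 : ℝ), hsn]
  exact lt_of_lt_of_le h1 (regevRadius_mono hr0.le hn hαp hi)

/-! ### The bootstrap bound `r_{3n} > 2^{2n} λₙ(L)` -/

section Lattice

variable {V : Type*} [NormedAddCommGroup V] [InnerProductSpace ℝ V] [FiniteDimensional ℝ V]
  (L : Submodule ℤ V) [DiscreteTopology L] [IsZLattice ℝ L]

/-- **Claim 2.13 for `ε ≤ e^{-π}`**: then `√(ln(1/ε)/π) ≥ 1`, so `λₙ(L) ≤ n η_ε(L)`.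
[cite: Regev2009, Claim 2.13] -/
theorem successiveMinimum_le_mul_smoothingParameter_of_le_exp_neg_pi [Nontrivial V] {ε : ℝ} (hε : 0 < ε)
    (hεπ : ε ≤ Real.exp (-Real.pi)) :
    successiveMinimum L (finrank ℝ V) ≤ finrank ℝ V * smoothingParameter L ε := by
  have hn : (0 : ℝ) < finrank ℝ V := by exact_mod_cast Module.finrank_pos
  have h := claim_2_13 L hε
  have hc : 1 ≤ Real.sqrt (Real.log (1 / ε) / Real.pi) := by
    rw [Real.le_sqrt' one_pos, one_pow, le_div_iff₀ Real.pi_pos, one_mul, one_div, Real.log_inv,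
      le_neg, ← Real.log_exp (-Real.pi)]
    exact Real.log_le_log hε hεπ
  have hsm : 0 ≤ successiveMinimum L (finrank ℝ V) / finrank ℝ V := div_nonneg (successiveMinimum_nonneg _ _) hn.le
  have h2 : successiveMinimum L (finrank ℝ V) / finrank ℝ V ≤ smoothingParameter L ε :=
    le_trans (by simpa using mul_le_mul_of_nonneg_right hc hsm) h
  rwa [div_le_iff₀ hn, mul_comm] at h2

/-- **"`r_{3n} > 2^{3n} r > 2^{2n} λₙ(L)`"**: the starting radius of the loop is above the bootstrap
threshold of Lemma 3.2, for `r > √(2n) η_ε(L)/α` with `0 < α < 1`, `αp > 2√n`, `0 < ε ≤ e^{-π}`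
(Claim 2.13: `λₙ ≤ n η_ε`, so `r > √2 λₙ/(√n α) ≥ 2⁻ⁿ λₙ`). [cite: Regev2009, Theorem 3.1 (proof)] -/
theorem two_pow_mul_successiveMinimum_lt_regevRadius [Nontrivial V] {r α ε : ℝ} {p : ℕ}
    (hα : 0 < α) (hα1 : α < 1) (hαp : 2 * Real.sqrt (finrank ℝ V) < α * p) (hε : 0 < ε)
    (hεπ : ε ≤ Real.exp (-Real.pi))
    (hr : Real.sqrt (2 * finrank ℝ V) * smoothingParameter L ε / α < r) :
    2 ^ (2 * finrank ℝ V) * successiveMinimum L (finrank ℝ V) < regevRadius r α p (finrank ℝ V) (3 * finrank ℝ V) := by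
  set n := finrank ℝ V with hn
  have hn0 : 0 < n := Module.finrank_pos
  have hnR : (1 : ℝ) ≤ n := by exact_mod_cast hn0
  have hsn : 0 < Real.sqrt n := Real.sqrt_pos.2 (by positivity)
  have hη : 0 ≤ smoothingParameter L ε := smoothingParameter_nonneg _ _
  have hr0 : 0 < r := lt_of_le_of_lt (by positivity) hr
  have hlam : successiveMinimum L n ≤ n * smoothingParameter L ε :=
    successiveMinimum_le_mul_smoothingParameter_of_le_exp_neg_pi L hε hεπ
  have hlam0 : 0 ≤ successiveMinimum L n := successiveMinimum_nonneg _ _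
  -- (a) `r > λₙ/(n·… )`: from `r α > √(2n) η ≥ √(2n) λₙ/n ≥ λₙ/√n ≥ λₙ/n`... we use `n η ≥ λₙ` and `√(2n) ≥ 1`
  have hsq1 : 1 ≤ Real.sqrt (2 * n) := Real.one_le_sqrt.2 (by linarith)
  have hra : successiveMinimum L n < n * r := by
    rw [div_lt_iff₀ hα] at hr
    -- `λₙ ≤ n η ≤ n √(2n) η < n r α < n r`
    have h1 : (n : ℝ) * smoothingParameter L ε ≤ n * (Real.sqrt (2 * n) * smoothingParameter L ε) := by
      refine mul_le_mul_of_nonneg_left ?_ (by positivity)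
      exact le_mul_of_one_le_left hη hsq1
    have h2 : (n : ℝ) * (Real.sqrt (2 * n) * smoothingParameter L ε) < n * (r * α) :=
      mul_lt_mul_of_pos_left hr (by positivity)
    have h3 : (n : ℝ) * (r * α) ≤ n * r := by
      refine mul_le_mul_of_nonneg_left ?_ (by positivity)
      exact mul_le_of_le_one_right hr0.le hα1.le
    linarith
  -- (b) `(αp/√n)^{3n} > 2^{3n}` and `2^{3n} r ≥ 2^{2n} · n r` since `2ⁿ ≥ n`
  have hratio : (2 : ℝ) < α * p / Real.sqrt n := two_lt_ratio hn0 hαp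
  have hpow : (2 : ℝ) ^ (3 * n) ≤ (α * p / Real.sqrt n) ^ (3 * n) :=
    pow_le_pow_left₀ zero_le_two hratio.le _
  have hn2 : (n : ℝ) ≤ 2 ^ n := by exact_mod_cast (Nat.lt_two_pow_self).le
  calc 2 ^ (2 * n) * successiveMinimum L n
      < 2 ^ (2 * n) * (n * r) := mul_lt_mul_of_pos_left hra (by positivity)
    _ ≤ 2 ^ (2 * n) * (2 ^ n * r) := by gcongr
    _ = r * 2 ^ (3 * n) := by ring
    _ ≤ r * (α * p / Real.sqrt n) ^ (3 * n) := mul_le_mul_of_nonneg_left hpow hr0.le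
    _ = regevRadius r α p n (3 * n) := rfl

end Lattice

end Regev2009

end Literature.Algebra.EuclideanLattices

end
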